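import Summits.CriticalPhenomena.Ising3DConformalLimit.Theorems.MonotoneBlockingMonotoneBlockingTwoKarlinDefs
import HarnessLib

/-!
# Stub `fold` of line `Sketch` (karlin-scale-tp2) for crux `MonotoneBlockingTwo` (stmt-CriticalPhenomena-17054)

Folding the scaled block integral to the open orthant by evenness: for a kernel `Γ` of the
Karlin class (even under each coordinate reflection) and every offset `k ∈ ℤ³`,
`blockIntegral Γ L k = foldedBlockIntegral Γ L |k|` (coordinatewise `natAbs`).

The proof is the one-dimensional identity
`∫_ℝ T(t − κ) ψ(t) dt = ∫_{t>0} [T(t − κ) + T(t + κ)] ψ(t) dt` for even `ψ` (the boundary `{0}` is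
Lebesgue-null, the tent is even), applied to the three nested integrals from the inside out; the
weights `ψ` of the two outer applications contain the already folded inner integrals, whose
measurability is Tonelli's measurability of partial integrals (`Measurable.lintegral_prod_right'`).
Mathlib only.
-/

noncomputable section

namespace Summit.CriticalPhenomena.Ising3DConformalLimit.Cruxes.MonotoneBlockingTwo.KarlinScaleTP2

open MeasureTheory Set
open scoped BigOperators ENNReal
open Literature.Probability.LatticeModels

/-! ## Elementary facts on the tent -/

/-- `ofReal` is additive on tent values (the tent is non-negative). -/
theorem ofReal_tent_add_tent (a b : ℝ) :
    ENNReal.ofReal (tent a + tent b) = ENNReal.ofReal (tent a) + ENNReal.ofReal (tent b) :=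
  ENNReal.ofReal_add (le_max_left _ _) (le_max_left _ _)

/-- Reflecting the argument of a shifted tent (the tent is even). -/
theorem tent_neg_sub (t c : ℝ) : tent (-t - c) = tent (t + c) := by
  unfold tent
  rw [show -t - c = -(t + c) by ring, abs_neg]

/-- The unit tent is continuous. -/
theorem continuous_tent : Continuous tent := by
  unfold tent
  exact continuous_const.max (continuous_const.sub continuous_abs)

/-- The folded tent is continuous in the real variable. -/
theorem continuous_foldedTent (n : ℕ) : Continuous fun t : ℝ => foldedTent t n := by
  unfold foldedTent
  exact (continuous_tent.comp (continuous_id.sub continuous_const)).add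
    (continuous_tent.comp (continuous_id.add continuous_const))

/-- The two shifted tents add up to the folded tent at the absolute value of the shift. -/
theorem tent_sub_add_tent_add (t : ℝ) (κ : ℤ) :
    tent (t - κ) + tent (t + κ) = foldedTent t κ.natAbs := by
  unfold foldedTent
  rw [Nat.cast_natAbs, Int.cast_abs]
  rcases le_total 0 (κ : ℝ) with h | h
  · rw [abs_of_nonneg h]
  · rw [abs_of_nonpos h, sub_neg_eq_add, ← sub_eq_add_neg, add_comm]

/-! ## Folding a Lebesgue integral over `ℝ` onto `(0,∞)` -/

/-- Reflection of the left half-line: `∫_{t ≤ 0} f t = ∫_{t > 0} f (-t)` (Lebesgue measure is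
invariant under `t ↦ -t`, and `{0}` is null). -/
theorem setLIntegral_Iic_eq_setLIntegral_Ioi_neg (f : ℝ → ℝ≥0∞) :
    ∫⁻ t in Iic (0:ℝ), f t = ∫⁻ t in Ioi (0:ℝ), f (-t) := by
  calc ∫⁻ t in Iic (0:ℝ), f t = ∫⁻ t, (Iic (0:ℝ)).indicator f t :=
        (lintegral_indicator measurableSet_Iic f).symm
    _ = ∫⁻ t, (Iic (0:ℝ)).indicator f (-t) :=
        (lintegral_neg_eq_self (μ := (volume : Measure ℝ)) ((Iic (0:ℝ)).indicator f)).symm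
    _ = ∫⁻ t, (Ici (0:ℝ)).indicator (fun t => f (-t)) t := by
        refine lintegral_congr fun t => ?_
        simp only [Set.indicator_apply, Set.mem_Iic, Set.mem_Ici, neg_nonpos]
    _ = ∫⁻ t in Ici (0:ℝ), f (-t) := lintegral_indicator measurableSet_Ici _
    _ = ∫⁻ t in Ioi (0:ℝ), f (-t) := setLIntegral_congr Ioi_ae_eq_Ici.symm

/-- Folding onto the open half-line: `∫_ℝ f = ∫_{t>0} f t + ∫_{t>0} f (-t)`. -/
theorem lintegral_eq_setLIntegral_Ioi_add (f : ℝ → ℝ≥0∞) :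
    ∫⁻ t, f t = (∫⁻ t in Ioi (0:ℝ), f t) + ∫⁻ t in Ioi (0:ℝ), f (-t) := by
  rw [← lintegral_add_compl f (measurableSet_Ioi (a := (0:ℝ))), compl_Ioi,
    setLIntegral_Iic_eq_setLIntegral_Ioi_neg]

/-- **The one-dimensional fold.** For a measurable even weight `ψ` and an integer shift `κ`,
`∫_ℝ T(t − κ) ψ(t) dt = ∫_{t>0} S(t, |κ|) ψ(t) dt` with `S` the folded tent. -/
theorem lintegral_tent_mul_fold {ψ : ℝ → ℝ≥0∞} (hψ : Measurable ψ) (heven : ∀ t, ψ (-t) = ψ t)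
    (κ : ℤ) :
    ∫⁻ t, ENNReal.ofReal (tent (t - κ)) * ψ t =
      ∫⁻ t in Ioi (0:ℝ), ENNReal.ofReal (foldedTent t κ.natAbs) * ψ t := by
  have hmeas : Measurable fun t : ℝ => ENNReal.ofReal (tent (t - κ)) * ψ t :=
    (ENNReal.measurable_ofReal.comp
      (continuous_tent.measurable.comp (measurable_id.sub_const _))).mul hψ
  rw [lintegral_eq_setLIntegral_Ioi_add (fun t => ENNReal.ofReal (tent (t - κ)) * ψ t),
    ← lintegral_add_left hmeas]
  refine lintegral_congr fun t => ?_
  rw [heven, tent_neg_sub, ← add_mul, ← ofReal_tent_add_tent, tent_sub_add_tent_add]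

/-! ## Measurability bookkeeping -/

/-- Measurability of `ofReal ∘ Γ` along measurable coordinate maps. -/
theorem KarlinClass.measurable_ofReal_comp {Γ : ℝ → ℝ → ℝ → ℝ} (hK : KarlinClass Γ)
    {α : Type*} [MeasurableSpace α] {a b c : α → ℝ}
    (ha : Measurable a) (hb : Measurable b) (hc : Measurable c) :
    Measurable fun x => ENNReal.ofReal (Γ (a x) (b x) (c x)) :=
  ENNReal.measurable_ofReal.comp (hK.measurable.comp (ha.prodMk (hb.prodMk hc)))

/-- Measurability of a folded-tent-weighted partial integral over `(0,∞)` in the remaining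
variables (Tonelli). -/
theorem measurable_setLIntegral_foldedTent_mul {α : Type*} [MeasurableSpace α] (n : ℕ)
    {Φ : α × ℝ → ℝ≥0∞} (hΦ : Measurable Φ) :
    Measurable fun a => ∫⁻ t in Ioi (0:ℝ), ENNReal.ofReal (foldedTent t n) * Φ (a, t) := by
  have h : Measurable fun q : α × ℝ => ENNReal.ofReal (foldedTent q.2 n) * Φ q :=
    (ENNReal.measurable_ofReal.comp ((continuous_foldedTent n).measurable.comp measurable_snd)).mul
      hΦ
  exact h.lintegral_prod_right'

/-! ## The stub -/

/-- **Stub `fold`.** For `Γ` in the Karlin class (even in each coordinate) and any `L`,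
`blockIntegral Γ L k = foldedBlockIntegral Γ L |k|` (coordinatewise `natAbs`): fold the three
nested integrals onto `(0,∞)` from the inside out by the one-dimensional fold. -/
theorem stub_fold : Sig.stub_fold := by
  intro Γ hK L _ k
  -- innermost integral (variable `s₃`), for all values of the outer variables
  have h3 : ∀ s₁ s₂ : ℝ,
      ∫⁻ s₃, ENNReal.ofReal (tent (s₃ - ((k 2 : ℤ) : ℝ))) *
          ENNReal.ofReal (Γ (L * s₁) (L * s₂) (L * s₃)) =
        ∫⁻ s₃ in Ioi (0:ℝ), ENNReal.ofReal (foldedTent s₃ (k 2).natAbs) *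
          ENNReal.ofReal (Γ (L * s₁) (L * s₂) (L * s₃)) := by
    intro s₁ s₂
    refine lintegral_tent_mul_fold ?_ ?_ (k 2)
    · exact hK.measurable_ofReal_comp measurable_const measurable_const
        (measurable_id'.const_mul L)
    · intro t
      simp only [mul_neg, hK.even₃]
  -- middle integral (variable `s₂`)
  have h2 : ∀ s₁ : ℝ,
      ∫⁻ s₂, ENNReal.ofReal (tent (s₂ - ((k 1 : ℤ) : ℝ))) *
          ∫⁻ s₃ in Ioi (0:ℝ), ENNReal.ofReal (foldedTent s₃ (k 2).natAbs) *
            ENNReal.ofReal (Γ (L * s₁) (L * s₂) (L * s₃)) =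
        ∫⁻ s₂ in Ioi (0:ℝ), ENNReal.ofReal (foldedTent s₂ (k 1).natAbs) *
          ∫⁻ s₃ in Ioi (0:ℝ), ENNReal.ofReal (foldedTent s₃ (k 2).natAbs) *
            ENNReal.ofReal (Γ (L * s₁) (L * s₂) (L * s₃)) := by
    intro s₁
    refine lintegral_tent_mul_fold ?_ ?_ (k 1)
    · exact measurable_setLIntegral_foldedTent_mul _
        (Φ := fun p : ℝ × ℝ => ENNReal.ofReal (Γ (L * s₁) (L * p.1) (L * p.2)))
        (hK.measurable_ofReal_comp measurable_const (measurable_fst.const_mul L)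
          (measurable_snd.const_mul L))
    · intro t
      simp only [mul_neg, hK.even₂]
  -- outer integral (variable `s₁`)
  have h1 :
      ∫⁻ s₁, ENNReal.ofReal (tent (s₁ - ((k 0 : ℤ) : ℝ))) *
          ∫⁻ s₂ in Ioi (0:ℝ), ENNReal.ofReal (foldedTent s₂ (k 1).natAbs) *
            ∫⁻ s₃ in Ioi (0:ℝ), ENNReal.ofReal (foldedTent s₃ (k 2).natAbs) *
              ENNReal.ofReal (Γ (L * s₁) (L * s₂) (L * s₃)) =
        ∫⁻ s₁ in Ioi (0:ℝ), ENNReal.ofReal (foldedTent s₁ (k 0).natAbs) *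
          ∫⁻ s₂ in Ioi (0:ℝ), ENNReal.ofReal (foldedTent s₂ (k 1).natAbs) *
            ∫⁻ s₃ in Ioi (0:ℝ), ENNReal.ofReal (foldedTent s₃ (k 2).natAbs) *
              ENNReal.ofReal (Γ (L * s₁) (L * s₂) (L * s₃)) := by
    refine lintegral_tent_mul_fold ?_ ?_ (k 0)
    · exact measurable_setLIntegral_foldedTent_mul _
        (Φ := fun p : ℝ × ℝ => ∫⁻ s₃ in Ioi (0:ℝ), ENNReal.ofReal (foldedTent s₃ (k 2).natAbs) *
          ENNReal.ofReal (Γ (L * p.1) (L * p.2) (L * s₃)))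
        (measurable_setLIntegral_foldedTent_mul _
          (Φ := fun q : (ℝ × ℝ) × ℝ => ENNReal.ofReal (Γ (L * q.1.1) (L * q.1.2) (L * q.2)))
          (hK.measurable_ofReal_comp (measurable_fst.fst.const_mul L)
            (measurable_fst.snd.const_mul L) (measurable_snd.const_mul L)))
    · intro t
      simp only [mul_neg, hK.even₁]
  unfold blockIntegral foldedBlockIntegral
  simp_rw [h3, h2]
  exact h1

end Summit.CriticalPhenomena.Ising3DConformalLimit.Cruxes.MonotoneBlockingTwo.KarlinScaleTP2

end
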